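import Summits.Ventures.HSemireg.ObstructionLocusCrossingExtTools

/-!
# Venture HSemireg — (S5) OBSTRUCTION LOCUS away from secant type, XXXIV: QUOTIENT ALGEBRA for the double cokernel —
# base change along a surjection, `J • ⊤`, and `(Π_t A ⧸ 𝔞_t) ⧸ J • ⊤ = Π_t A ⧸ (𝔞_t + J)`

HONEST FRAMING.  Part of the Lean side of the computation cell `pub-hsemireg` (track «S4-PUSH» (ii), seat
s4-prove-2).  GENERIC linear algebra over a commutative ring `A` (file XXXI's scalar matrices).  Nothing here
constructs a variety or a sheaf; nothing here says that HC / HC_CM / HC_AV holds; no Literature fact is declared or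
used; no object is certified.

* **`quotMapEquivOfSurjective`** — for `θ : M ↠ M''` and `W ≤ M`: `M ⧸ (W ⊔ ker θ) ≃ₗ[A] M'' ⧸ W.map θ`;
  `ker_compLeft₂_mkQ` — the kernel of `mkQ_J` entrywise on `A^{T₁ × T₂}` is `J • ⊤`; `compLeft₂_mkQ_surjective`;
* `map_mkQ_smul_top`, **`quotSupSmulTopEquiv : M ⧸ (W ⊔ J • ⊤) ≃ₗ[A] (M ⧸ W) ⧸ J • ⊤`**, `map_equiv_smul_top`,
  `quotSmulTopCongr`, `smul_top_eq_pi`, `quotQuotSmulTopEquiv : (A ⧸ 𝔞) ⧸ J • ⊤ ≃ₗ[A] A ⧸ (𝔞 ⊔ J)`,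
  **`piQuotSmulTopEquiv : (Π_t A ⧸ 𝔞_t) ⧸ J • ⊤ ≃ₗ[A] Π_t A ⧸ (𝔞_t ⊔ J)`**.
References (dictionary only): EXT-NOTE.md §6.B(c).
-/

open scoped BigOperators

universe u

namespace Summit.Ventures.HSemireg.ObstructionLocus

variable {A : Type u} [CommRing A]

/-! ## Base change along a surjection -/

section BaseChange

variable {M M'' : Type u} [AddCommGroup M] [Module A M] [AddCommGroup M''] [Module A M'']

/-- **For `θ : M ↠ M''` and `W ≤ M`: `M'' ⧸ W.map θ ≃ₗ[A] M ⧸ (W ⊔ ker θ)`.** -/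
noncomputable def quotMapEquivOfSurjective (θ : M →ₗ[A] M'') (hθ : Function.Surjective θ) (W : Submodule A M) :
    (M ⧸ (W ⊔ LinearMap.ker θ)) ≃ₗ[A] (M'' ⧸ W.map θ) := by
  refine LinearEquiv.ofBijective ((W ⊔ LinearMap.ker θ).liftQ ((W.map θ).mkQ ∘ₗ θ) ?_) ⟨?_, ?_⟩
  · rw [sup_le_iff]
    constructor
    · intro m hm
      rw [LinearMap.mem_ker, LinearMap.comp_apply, Submodule.mkQ_apply, Submodule.Quotient.mk_eq_zero]
      exact ⟨m, hm, rfl⟩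
    · intro m hm
      rw [LinearMap.mem_ker] at hm
      rw [LinearMap.mem_ker, LinearMap.comp_apply, hm, map_zero]
  · rw [← LinearMap.ker_eq_bot, Submodule.eq_bot_iff]
    intro q hq
    obtain ⟨m, rfl⟩ := Submodule.Quotient.mk_surjective _ q
    rw [LinearMap.mem_ker, Submodule.liftQ_apply, LinearMap.comp_apply, Submodule.mkQ_apply,
      Submodule.Quotient.mk_eq_zero] at hq
    obtain ⟨w, hw, hwm⟩ := hq
    rw [Submodule.Quotient.mk_eq_zero]
    have : m = w + (m - w) := by abel
    rw [this]
    exact Submodule.add_mem_sup hw (by rw [LinearMap.mem_ker, map_sub, hwm, sub_self])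
  · intro q
    obtain ⟨m'', rfl⟩ := Submodule.Quotient.mk_surjective _ q
    obtain ⟨m, rfl⟩ := hθ m''
    exact ⟨Submodule.Quotient.mk m, rfl⟩

/-- `quotMapEquivOfSurjective` on representatives. -/
theorem quotMapEquivOfSurjective_mk (θ : M →ₗ[A] M'') (hθ : Function.Surjective θ) (W : Submodule A M) (m : M) :
    quotMapEquivOfSurjective θ hθ W (Submodule.Quotient.mk m) = Submodule.Quotient.mk (θ m) := rfl

variable {T₁ T₂ : Type}

/-- The kernel of `mkQ_J` entrywise on `A^{T₁ × T₂}` is `J • ⊤`. -/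
theorem ker_compLeft₂_mkQ [Fintype T₁] [Fintype T₂] [DecidableEq T₁] [DecidableEq T₂] (J : Ideal A) :
    LinearMap.ker (compLeft₂ (T₁ := T₁) (T₂ := T₂) J.mkQ) = J • (⊤ : Submodule A (T₁ → T₂ → A)) := by
  apply le_antisymm
  · intro f hf
    rw [LinearMap.mem_ker] at hf
    have hfJ : ∀ i j, f i j ∈ J := by
      intro i j
      have := congr_fun (congr_fun hf i) j
      change Submodule.Quotient.mk (f i j) = (0 : A ⧸ J) at this
      exact (Submodule.Quotient.mk_eq_zero J).1 this
    have : f = ∑ i, ∑ j, f i j • (Pi.single i (Pi.single j (1 : A)) : T₁ → T₂ → A) := by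
      funext i' j'
      simp only [Finset.sum_apply, Pi.smul_apply, smul_eq_mul]
      rw [Finset.sum_eq_single i', Finset.sum_eq_single j']
      · simp
      · intro j _ hj; simp [Ne.symm hj]
      · intro h; exact absurd (Finset.mem_univ _) h
      · intro i _ hi; simp [Ne.symm hi]
      · intro h; exact absurd (Finset.mem_univ _) h
    rw [this]
    exact Submodule.sum_mem _ fun i _ => Submodule.sum_mem _ fun j _ =>
      Submodule.smul_mem_smul (hfJ i j) Submodule.mem_top
  · rw [Submodule.smul_le]
    intro r hr f _
    rw [LinearMap.mem_ker]
    funext i j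
    change Submodule.Quotient.mk (r * f i j) = (0 : A ⧸ J)
    exact (Submodule.Quotient.mk_eq_zero J).2 (J.mul_mem_right (f i j) hr)

/-- `mkQ_J` entrywise is onto. -/
theorem compLeft₂_mkQ_surjective (J : Ideal A) :
    Function.Surjective (compLeft₂ (T₁ := T₁) (T₂ := T₂) J.mkQ) := fun v =>
  ⟨fun i j => (Submodule.Quotient.mk_surjective J (v i j)).choose,
    funext fun i => funext fun j => (Submodule.Quotient.mk_surjective J (v i j)).choose_spec⟩

end BaseChange

/-! ## Quotient algebra: `(M ⧸ W) ⧸ J • ⊤`, transport, and finite products of cyclic modules -/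

section QuotAlgebra

variable {M M' : Type u} [AddCommGroup M] [Module A M] [AddCommGroup M'] [Module A M']

/-- `(J • ⊤).map W.mkQ = J • ⊤`. -/
theorem map_mkQ_smul_top (W : Submodule A M) (J : Ideal A) :
    (J • (⊤ : Submodule A M)).map W.mkQ = J • ⊤ := by
  rw [Submodule.map_smul'', Submodule.map_top, Submodule.range_mkQ]

/-- **`M ⧸ (W ⊔ J • ⊤) ≃ₗ[A] (M ⧸ W) ⧸ J • ⊤`.** -/
noncomputable def quotSupSmulTopEquiv (W : Submodule A M) (J : Ideal A) :
    (M ⧸ (W ⊔ J • (⊤ : Submodule A M))) ≃ₗ[A] ((M ⧸ W) ⧸ J • (⊤ : Submodule A (M ⧸ W))) :=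
  (Submodule.quotientQuotientEquivQuotientSup W (J • ⊤)).symm.trans
    (Submodule.quotEquivOfEq _ _ (map_mkQ_smul_top W J))

/-- Transport of `J • ⊤` along a linear equivalence. -/
theorem map_equiv_smul_top (e : M ≃ₗ[A] M') (J : Ideal A) :
    (J • (⊤ : Submodule A M)).map (e : M →ₗ[A] M') = J • ⊤ := by
  rw [Submodule.map_smul'', Submodule.map_top, LinearEquiv.range]

/-- `(M ⧸ J • ⊤) ≃ₗ (M' ⧸ J • ⊤)` along `e : M ≃ M'`. -/
noncomputable def quotSmulTopCongr (e : M ≃ₗ[A] M') (J : Ideal A) :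
    (M ⧸ J • (⊤ : Submodule A M)) ≃ₗ[A] (M' ⧸ J • (⊤ : Submodule A M')) :=
  Submodule.Quotient.equiv _ _ e (map_equiv_smul_top e J)

variable {τ : Type} [Fintype τ] [DecidableEq τ]

/-- `J • ⊤ = Π_t (J • ⊤)` in a finite product. -/
theorem smul_top_eq_pi (P : τ → Type u) [∀ t, AddCommGroup (P t)] [∀ t, Module A (P t)] (J : Ideal A) :
    J • (⊤ : Submodule A ((t : τ) → P t)) = Submodule.pi Set.univ (fun t => J • (⊤ : Submodule A (P t))) := by
  apply le_antisymm
  · rw [Submodule.smul_le]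
    intro r hr f _
    rw [Submodule.mem_pi]
    intro t _
    exact Submodule.smul_mem_smul hr Submodule.mem_top
  · intro f hf
    rw [Submodule.mem_pi] at hf
    have : f = ∑ t, Pi.single t (f t) := by
      rw [Finset.univ_sum_single]
    rw [this]
    refine Submodule.sum_mem _ fun t _ => ?_
    have hft := hf t (Set.mem_univ t)
    refine Submodule.smul_induction_on hft ?_ ?_
    · intro r hr x _
      have hsingle : (Pi.single t (r • x) : (t : τ) → P t) = r • Pi.single t x := by
        funext t'
        by_cases h : t' = t
        · subst h; simp
        · simp [h]
      rw [hsingle]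
      exact Submodule.smul_mem_smul hr Submodule.mem_top
    · intro x y hx hy
      rw [Pi.single_add]
      exact Submodule.add_mem _ hx hy

/-- `(A ⧸ 𝔞) ⧸ J • ⊤ ≃ₗ[A] A ⧸ (𝔞 ⊔ J)`. -/
noncomputable def quotQuotSmulTopEquiv (𝔞 J : Ideal A) :
    ((A ⧸ 𝔞) ⧸ J • (⊤ : Submodule A (A ⧸ 𝔞))) ≃ₗ[A] (A ⧸ (𝔞 ⊔ J)) := by
  refine (Submodule.quotEquivOfEq _ _ ?_).trans (Submodule.quotientQuotientEquivQuotientSup 𝔞 J)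
  -- `J • ⊤ = J.map 𝔞.mkQ`
  apply le_antisymm
  · rw [Submodule.smul_le]
    intro r hr x _
    obtain ⟨y, rfl⟩ := Submodule.Quotient.mk_surjective 𝔞 x
    refine ⟨r * y, J.mul_mem_right y hr, ?_⟩
    rw [Submodule.mkQ_apply, ← smul_eq_mul, Submodule.Quotient.mk_smul]
  · rintro _ ⟨j, hj, rfl⟩
    have : 𝔞.mkQ j = j • Submodule.Quotient.mk (1 : A) := by
      rw [Submodule.mkQ_apply, ← Submodule.Quotient.mk_smul, smul_eq_mul, mul_one]
    rw [this]
    exact Submodule.smul_mem_smul hj Submodule.mem_top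

/-- **`(Π_t A ⧸ 𝔞_t) ⧸ J • ⊤ ≃ₗ[A] Π_t A ⧸ (𝔞_t ⊔ J)`.** -/
noncomputable def piQuotSmulTopEquiv (𝔞 : τ → Ideal A) (J : Ideal A) :
    (((t : τ) → A ⧸ 𝔞 t) ⧸ J • (⊤ : Submodule A ((t : τ) → A ⧸ 𝔞 t))) ≃ₗ[A] ((t : τ) → A ⧸ (𝔞 t ⊔ J)) :=
  (Submodule.quotEquivOfEq _ _ (smul_top_eq_pi (fun t => A ⧸ 𝔞 t) J)).trans
    ((Submodule.quotientPi _).trans (LinearEquiv.piCongrRight fun t => quotQuotSmulTopEquiv (𝔞 t) J))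

end QuotAlgebra

end Summit.Ventures.HSemireg.ObstructionLocus
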